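import Mathlib
import Literature.Analysis.FluidPDE.Tao2016AveragedNS.ShiftSetCascadeFlows
import Literature.Analysis.FluidPDE.Tao2016AveragedNS.ShiftSetCascadeFlux
import Summits.NavierStokesRegularity.NavierStokesRegularity.Theorems.TaoLadderRungTwoFlatCertificateGlueCertificateFinalOn
import Summits.NavierStokesRegularity.NavierStokesRegularity.Theorems.TaoLadderRungTwoFlatCertificateGlueCheckerLandGenOn
import HarnessLib

/-!
# Certificate glue on a shift set `𝕊`, XXXVI-b: THE FINAL ASSEMBLY OVER A GENERIC COEFFICIENT-BOX TABLE — glue XXXVI `stub_rung_quarter_of_certificateV` with the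
  branch / readout / landing checkers of glue XXIX-d / XXXV-b over any table `cB` with `CoefBoxOK` (for the checked lookup table of glue XXV-m:
  `coefBoxOK_lookup` of the Boolean `checkCoefTab`) (helper for item stmt-NavierStokesRegularity-22987 `FlatGapCertificatesV2` (crux K_A♭ of route
  TaoLadderRungTwoFlat); cell harvest/h2-tao-ladder, p1 g16; PERFORMANCE refactor: the instance evaluates tabulated coefficient boxes)

HONEST FRAMING: Tao-type MODEL lattice `T♭(½)` on `S♭` at `ε₀ = ¼`; soundness of the certificate FORMAT — NO certificate instance exists in the tree,
nothing is certified here, no stub is closed by this file, nothing here is a statement about the Navier–Stokes equations.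
-/

noncomputable section

-- the sub-problem namespace repeats the summit name by design (D-0017)
set_option linter.dupNamespace false

namespace Summit.NavierStokesRegularity.NavierStokesRegularity.Theorems

open Set Finset Literature.Analysis.FluidPDE Literature.Analysis.FluidPDE.TaoCascade
open Summit.NavierStokesRegularity.NavierStokesRegularity.Theorems.TaylorModelCert

namespace CertificateGlueOn

/-! ### The final assembly -/

/-- **THE REGISTERED STUB `stub_rung_quarter` FROM A CHECKED LAYOUT-V CERTIFICATE OVER A GENERIC COEFFICIENT-BOX TABLE**: glue IX
`stub_rung_quarter_of_checks` with `htrap` := glue XXIX-d `htrap_of_chainChecksG`, `hland` := glue XXXV-b `hland_of_chainChecksG`, the core `Z := coreFam refs`, and `hcore` / `hdatum` /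
`hcoreTop` / `hinside` / `hcover` from `checkRef` / `checkDatum`.
[cite: Tao2016AveragedNS, §6.3–6.4 Props. 6.4–6.5 (statement shape of a renormalisation certificate); route TaoLadderRungTwoFlat, crux K_A♭, stub_rung_quarter, certificate format] -/
theorem stub_rung_quarter_of_certificateG
    -- window, datum, weights in the coordinates
    {Kb Ka : ℤ} (hKb : 0 ≤ Kb) (hKa : 4 ≤ Ka) {x0q : Fin 2 → ℚ} (hx0 : x0q 0 ≠ 0) {ωq : Fin 2 → ℤ → ℚ} (hω : ∀ i k, 0 < ωq i k)
    -- glue IX's reals, tied to rationals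
    {M w : ℤ → ℝ} {Mq wq : ℤ → ℚ} (hM : ∀ k, M k = (Mq k : ℝ)) (hwq : ∀ k, w k = (wq k : ℝ))
    {r ρ θ₀ θ c₀ c σ : ℝ} {rq ρq c₀q cq σq : ℚ} {θn θd : ℕ} (hrq : r = (rq : ℝ)) (hρq : ρ = (ρq : ℝ))
    (hθ₀q : θ₀ = (θn : ℝ) / (θd : ℝ)) (hc₀q : c₀ = (c₀q : ℝ)) (hcq : c = (cq : ℝ)) (hσq : σ = (σq : ℝ))
    (hr : 0 < r) (hρ : 0 ≤ ρ) (hρ1 : ρ < 1) (hθ₀ : 0 ≤ θ₀) (hθ₀θ : θ₀ < θ) (hθ : θ ≤ 1 / 2) (hc₀ : 0 < c₀) (hc₀c : c₀ < c) (hσ : 0 < σ)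
    {Mmax : ℝ} (hMmax : ∀ k, -Kb ≤ k → k ≤ Ka → M k ≤ Mmax)
    -- the piecewise-Gaussian weight
    {Cw b : ℝ} (hCw : 1 ≤ Cw) (hb : 1 / 2 ≤ b)
    (hwp : ∀ k : ℤ, 0 ≤ k → w k = Cw * (2 : ℝ) ^ ((k : ℝ) ^ 2 / 2 + b * k)) (hwn : ∀ k : ℤ, k < 0 → w k = Cw)
    -- wake side
    {Zb Zf : ℤ → ℝ} {Cb γ : ℝ} (hCb : 0 < Cb) (hγ0 : 0 ≤ γ) (hγ1 : γ ≤ 1)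
    (hZb : ∀ j : ℤ, Zb j = Cb * (1 + (1 / 4 : ℝ)) ^ (-(γ * j)))
    (hZf : ∀ j : ℤ, Zf j = 2 * (Zb j + r / Cw)) (hMZf : M (-Kb) ≤ Zf (-Kb))
    (checkB₁ : 32 * c * 28 * (1 + (1 / 4 : ℝ)) ^ (2 * γ) *
      ((1 + (1 / 4 : ℝ)) ^ ((5 : ℝ) * ((-Kb - 1 : ℤ) : ℝ) / 2) * (Zb (-Kb - 1) + r / Cw)) ≤ 1)
    (checkB₂ : (1 + (1 / 4 : ℝ)) ^ θ₀ * (Zb (-Kb - 1) + r / Cw +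
      32 * c * 28 * (1 + (1 / 4 : ℝ)) ^ (2 * γ) *
        ((1 + (1 / 4 : ℝ)) ^ ((5 : ℝ) * ((-Kb - 1 : ℤ) : ℝ) / 2) * (Zb (-Kb - 1) + r / Cw) ^ 2)) ≤ Zb (-Kb - 1 - 1))
    -- quiet side
    {ν : ℤ → ℝ} {ν₀ ν₁ ϑ : ℝ}
    (hνKa : ν Ka = ν₀) (hνhi : ∀ K : ℤ, Ka + 1 ≤ K → ν K = ν₁) (hν₀ : 0 ≤ ν₀) (hν₁ : 0 ≤ ν₁)
    (hMν : M Ka ≤ ν₀ * r / w (Ka - 1))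
    (checkA₁ : (1 + (1 / 4 : ℝ)) ^ ((5 : ℝ) * ((Ka + 1 : ℤ) : ℝ) / 2) * r * w (Ka + 1 - 1) ≤ ϑ * w (Ka + 1 - 2) ^ 2)
    (checkA₂ : (1 + (1 / 4 : ℝ)) ^ ((5 : ℝ) * ((Ka : ℤ) : ℝ) / 2) *
      coeffAbsOn (botShifts shiftSetFlat) (mirrorTable (1 / 2) (1 / 2)) * c * (ν₀ * r / w (Ka - 1)) ≤ 1 / 2)
    (checkA₃ : (1 + (1 / 4 : ℝ)) ^ ((5 : ℝ) * ((Ka + 1 : ℤ) : ℝ) / 2) *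
      coeffAbsOn (botShifts shiftSetFlat) (mirrorTable (1 / 2) (1 / 2)) * c * (ν₁ * r / w Ka) ≤ 1 / 2)
    (checkA₄ : 2 * (Real.sqrt 2 * Real.sqrt (4 / 3 * (2 : ℕ) * (25 / 32)) / (2 * (1 + (1 / 4 : ℝ)) ^ ((Ka : ℤ) : ℝ)) +
      coeffAbsOn (botShifts shiftSetFlat) (mirrorTable (1 / 2) (1 / 2)) * c *
        (ϑ / (1 + (1 / 4 : ℝ)) ^ ((5 : ℝ) / 2)) * ν₀ ^ 2) ≤ ν₁)
    (checkA₅ : 2 * (Real.sqrt 2 * Real.sqrt (4 / 3 * (2 : ℕ) * (25 / 32)) / (2 * (1 + (1 / 4 : ℝ)) ^ ((Ka + 1 : ℤ) : ℝ)) +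
      coeffAbsOn (botShifts shiftSetFlat) (mirrorTable (1 / 2) (1 / 2)) * c *
        (ϑ / (1 + (1 / 4 : ℝ)) ^ ((5 : ℝ) / 2)) * ν₁ ^ 2) ≤ ν₁)
    (checkA₆ : ν₁ * (1 + (1 / 4 : ℝ)) ^ θ₀ ≤ ρ)
    -- the envelope values used by the checkers
    {Eb Et Zx lev : ℚ} (hEb : Zf (-Kb - 1) = (Eb : ℝ)) (hEt : ν (Ka + 1) * r / w Ka = (Et : ℝ)) (hZx : Zb (-Kb - 1) = (Zx : ℝ))
    -- THE CERTIFICATE: global data, branch chains, section records, readout constants, reference states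
    {prec p kexp nexp : ℕ} {Sp Sm : IntervalD} {bD : Dyad}
    {ι : Type*} {rec : ι → ℕ → VRec} {N j₁ j₂ : ι → ℕ} {sr : ι → ℕ → SecRec} {qz : Array ℤ} {a : ι → ℕ → ℚ}
    {L : ℕ} {refs : Fin L → Array Dyad} {start : Fin L → ι} {tgt : ι → ℕ → Fin L} {l₀ : Fin L}
    {cB : Fin 2 → ℤ → Fin 2 → Fin 2 → ℤ × ℤ × ℤ → IntervalD}
    (hcoef : CoefBoxOK shiftsFlat (((1 / 4 : ℚ)) : ℝ) (fun i₁ i₂ i μ => ((mirrorTableQ (1 / 2) (1 / 2) i₁ i₂ i μ : ℚ) : ℝ)) Kb Ka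
      (fun i k => (ωq i k : ℝ)) cB)
    (hg : checkGlobalG 2 Kb Ka prec shiftsFlat cB (1 / 4) Sp Sm bD = true)
    (hs : ∀ bb j, j < N bb → checkStepG 2 Kb Ka prec p kexp nexp shiftsFlat cB (mirrorTableQ (1 / 2) (1 / 2)) ωq Sp Sm bD Eb Et (rec bb) j = true)
    (htr : ∀ bb j, j < N bb → checkTransit 2 Kb Ka ωq Mq (rec bb j).lo (rec bb j).hi = true)
    (hcN : ∀ bb, cq ≤ sumHV (rec bb) (N bb))
    (hj : ∀ bb, j₁ bb ≤ j₂ bb) (hjN : ∀ bb, j₂ bb < N bb)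
    (hsec : ∀ bb j, j₁ bb ≤ j → j ≤ j₂ bb →
      checkSection 2 Kb Ka prec shiftsFlat (cB) qz (rec bb j).lo (rec bb j).hi (rec bb j).δ
        (sr bb j) = true)
    (hread : ∀ bb j, j₁ bb ≤ j → j ≤ j₂ bb →
      checkReadout 2 Kb Ka ωq 0 (1 / 4) σq (a bb j) ρq rq Zx Et θn θd wq (refs (tgt bb j))
        (xsArr (2 * winLen Kb Ka) qz (sr bb j) (rec bb j).x lev)
        (rsArr (2 * winLen Kb Ka) qz (sr bb j) (rec bb j).E (rec bb j).r (rec bb j).C (rec bb j).h) = true)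
    (hbefore : ∀ bb, checkSecBelow (2 * winLen Kb Ka) qz (rec bb (j₁ bb)) lev = true)
    (hafter : ∀ bb, checkSecAbove (2 * winLen Kb Ka) qz (rec bb (j₂ bb + 1)) lev = true)
    (hpos : ∀ bb, 0 < sumHV (rec bb) (j₁ bb)) (hc₀N : ∀ bb, sumHV (rec bb) (j₂ bb + 1) ≤ c₀q)
    (hid : ∀ bb, checkIdFrame (2 * winLen Kb Ka) (rec bb 0).C = true) (hE : ∀ bb, checkNonneg (2 * winLen Kb Ka) (rec bb 0).E = true)
    (hrefs : ∀ l, checkRef Kb Ka ωq wq Mq rq (refs l) (rec (start l) 0).x (rec (start l) 0).r = true)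
    (hdat : checkDatum Kb Ka x0q (refs l₀) = true) :
    ∃ (σ : ℝ) (X₀ : Fin 2 → ℝ) (Z : Set (Fin 2 → ℤ → ℝ)) (w : ℤ → ℝ) (r ρ θ₀ θ c₀ c : ℝ) (env₀ : ℤ → ℝ),
      X₀ 0 ≠ 0 ∧
        GapData₂On shiftSetFlat σ (1 / 4) (0 : Fin 2) (mirrorTable (1 / 2) (1 / 2)) X₀ Z w r ρ θ₀ θ c₀ c env₀ ∧
          TailThin (1 / 4) w r ∧
            ∃ (Cw b : ℝ), 1 ≤ Cw ∧ 1 / 2 ≤ b ∧ ∀ k : ℤ, 0 ≤ k → w k = Cw * (2 : ℝ) ^ ((k : ℝ) ^ 2 / 2 + b * k) := by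
  -- tie the reals to the rationals
  have hMfun : M = fun k => (Mq k : ℝ) := funext hM
  have hwfun : w = fun k => (wq k : ℝ) := funext hwq
  subst hMfun hwfun hrq hρq hθ₀q hc₀q hcq hσq
  have hKa1 : 1 ≤ Ka := by omega
  have hq : (0 : ℝ) < 1 + ((1 / 4 : ℚ) : ℝ) := by push_cast; norm_num
  have hqe : ((1 / 4 : ℚ) : ℝ) = (1 / 4 : ℝ) := by push_cast; ring
  have h𝕊 : IsNearestNeighbourSet shiftsFlat.toFinset := by rw [shiftsFlat_toFinset]; exact isNearestNeighbourSet_shiftSetFlat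
  -- the datum and the core
  set X₀ : Fin 2 → ℝ := fun i => (x0q i : ℝ) with hX₀def
  have hX₀ : X₀ 0 ≠ 0 := by simp only [hX₀def]; exact_mod_cast hx0
  set Core : (Fin 2 → ℤ → ℝ) → Prop := coreFam Kb Ka refs with hCore
  have hcore : ∀ z z' : Fin 2 → ℤ → ℝ, (∀ i k, -Kb ≤ k → k ≤ Ka → z i k = z' i k) → Core z → Core z' := by
    intro z z' hzz' ⟨l, hl⟩
    exact ⟨l, fun i k hk1 hk2 => (hzz' i k hk1 hk2).symm.trans (hl i k hk1 hk2)⟩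
  have hdatum : Core (datumState (0 : Fin 2) X₀) := by
    refine ⟨l₀, fun i k hk1 hk2 => ?_⟩
    have hw : -Kb ≤ k ∧ k ≤ Ka := ⟨hk1, hk2⟩
    simp only [checkDatum, List.all_eq_true, List.mem_finRange, List.mem_range, decide_eq_true_eq, true_implies] at hdat
    have hcc : (k + Kb).toNat < winLen Kb Ka := by unfold winLen; rw [Int.toNat_lt_toNat (by omega)]; omega
    have h1 := hdat i (k + Kb).toNat hcc
    rw [Int.toNat_of_nonneg (by omega), show k + Kb - Kb = k by ring] at h1
    unfold zstate; rw [dif_pos hw, idxOf_val i hw, ← cast_dyadToRat, h1]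
    simp only [datumState, hX₀def]
    push_cast
    split_ifs <;> simp
  have hcoreTop : ∀ z, Core z → ∀ i, 4 * ((wq Ka : ℝ) * |z i Ka|) ≤ (rq : ℝ) := by
    intro z ⟨l, hl⟩ i
    have hw : -Kb ≤ Ka ∧ Ka ≤ Ka := ⟨by omega, le_rfl⟩
    obtain ⟨-, -, -, h4⟩ := checkRef_at (hrefs l) i hw
    have h4r := (Rat.cast_le (K := ℝ)).mpr (h4 rfl)
    simp only [Rat.cast_mul, Rat.cast_abs, Rat.cast_ofNat, cast_dyadToRat] at h4r
    rw [hl i Ka hw.1 hw.2]; unfold zstate; rw [dif_pos hw]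
    exact h4r
  have hinside : ∀ (z S₀ : Fin 2 → ℤ → ℝ), Core z →
      (∀ i k, -Kb ≤ k → k ≤ Ka → (wq k : ℝ) * |S₀ i k - z i k| ≤ (rq : ℝ)) → ∀ i k, -Kb ≤ k → k ≤ Ka → |S₀ i k| < (Mq k : ℝ) :=
    fun z S₀ ⟨l, hl⟩ hS => (ref_consequences hω hKb hKa1 (hrefs l) hl hS).1
  have hcover : ∀ (z S₀ : Fin 2 → ℤ → ℝ), Core z → (∀ i k, -Kb ≤ k → k ≤ Ka → (wq k : ℝ) * |S₀ i k - z i k| ≤ (rq : ℝ)) →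
      ∃ bb, ∀ d, |pxcoord Kb Ka (fun i k => (ωq i k : ℝ)) S₀ d - dvec (n := 2 * winLen Kb Ka) (rec bb 0).x d| ≤
        dvec (n := 2 * winLen Kb Ka) (rec bb 0).r d :=
    fun z S₀ ⟨l, hl⟩ hS => ⟨start l, (ref_consequences hω hKb hKa1 (hrefs l) hl hS).2⟩
  -- the two dynamic clauses from the chain checkers
  have htrap0 := htrap_of_chainChecksG (Core := Core) (w := fun k => (wq k : ℝ)) (r := (rq : ℝ)) hKb hKa1 shiftsFlat_nodup h𝕊 hω hcoef
    (c := cq) (Mq := Mq) hg hs htr hcN hid hE hcover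
  have hland0 := hland_of_chainChecksG (Core := Core) (w := wq) (r := rq) hKb hKa1 shiftsFlat_nodup h𝕊 hq hω hcoef (lev := lev) (c₀ := c₀q)
    (Mq := Mq) (i₀ := (0 : Fin 2)) (σ := σq) (ρ := ρq) (Zx := Zx) (θn := θn) (θd := θd) (a := a) (zc := fun bb j => refs (tgt bb j))
    hg hj (fun bb j hjb => hs bb j (by have := hjN bb; omega)) hsec hread (fun bb j _ _ => ⟨tgt bb j, fun i k _ _ => rfl⟩) hbefore hafter hpos
    hc₀N hid hE hcover
  rw [shiftsFlat_toFinset, cast_mirrorTableQ_half, hqe] at htrap0 hland0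
  rw [← hZx] at hland0
  refine stub_rung_quarter_of_checks hX₀ hKb hKa hr hρ hρ1 hθ₀ hθ₀θ hθ hc₀ hc₀c hσ hMmax hcore hdatum hCw hb hwp hwn hCb hγ0 hγ1 hZb hZf
    hMZf checkB₁ checkB₂ hcoreTop hνKa hνhi hν₀ hν₁ hMν checkA₁ checkA₂ checkA₃ checkA₄ checkA₅ checkA₆ hinside ?_ ?_
  · intro s z S hz hs0 hsc hS0 hd hcb hct hbb hbt hMb
    exact htrap0 s z S hz hs0 hsc hS0 hd hcb hct (fun i u hu => (hbb i u hu).trans_eq hEb) (fun i u hu => (hbt i u hu).trans_eq hEt) hMb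
  · intro z S hz hS0 hd hcb hct hbb hbt hMb
    obtain ⟨τ₁, a', z', h1, h2, h3, h4, h5, h6, h7, h8, h9⟩ :=
      hland0 z S hz hS0 hd hcb hct (fun i u hu => (hbb i u hu).trans_eq hEb) (fun i u hu => (hbt i u hu).trans_eq hEt) hMb
    exact ⟨τ₁, a', z', h1, h2, h3, h4, h5, h6, h7, fun i v hv => h8 i v (hv.trans_eq hEt), h9⟩

end CertificateGlueOn

end Summit.NavierStokesRegularity.NavierStokesRegularity.Theorems

end
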